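import Mathlib
import Summits.AtomisticToContinuum.Crystallization.Theorems.NashClassCertificatesNashNearFieldStubLayerLandscapeTri

/-!
# Crux `NashNearField` (16827), stubs `stub_triLandscapeNear` / `stub_triLandscapeFar`: the term-wise interval calculus
# of the retained layer sums on a box of the triangular gauge

After `stub_triTruncation` every box of the branch and bound is reduced to a LOWER bound of finitely many terms
`V_LJ(√q_t(X, Y, Z))` (`q_t = (t₀₀X + t₀₁Y + t₀₂Z)² + (t₁₁Y + t₁₂Z)² + (t₂₂Z)²`, `(X, Y, Z)` the rational-times-`√3`, `√6`
coordinates of a template vector) uniformly over the box `|t_k − c_k| ≤ ε_k`, and to exact values of finitely many reference terms.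
This file is that calculus, in `norm_num`-ready form:
* `tri_lj_sqrt_eq` — `V_LJ(√q) = q⁻⁶/12 − q⁻³/6` (`q > 0`): the terms are rational functions of the squared distance;
* `tri_lj_sqrt_mono` / `tri_lj_sqrt_anti` / `tri_lj_sqrt_ge` — `q ↦ V_LJ(√q)` is increasing on `[1, ∞)`, decreasing on `(0, 1]`,
  and `≥ −1/12` everywhere, so on `q ∈ [lo, hi]` the term is `≥ V(√lo)` (`lo ≥ 1`), `≥ V(√hi)` (`hi ≤ 1`), `≥ −1/12` (else):
  `tri_lj_sqrt_ge_of_mem`;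
* `tri_linform_dev`, `tri_sq_le_of_dev`, `tri_sq_ge_of_dev`, `tri_qbox_le`, `tri_qbox_ge` — the enclosure of `q_t(X,Y,Z)` over a box:
  `∑_r (|L_r(c)| − ρ_r)₊² ≤ q_t ≤ ∑_r (|L_r(c)| + ρ_r)²` with `L₀(c) = c₀₀X + c₀₁Y + c₀₂Z`, `ρ₀ = ε₀₀|X| + ε₀₁|Y| + ε₀₂|Z|`, etc.
Per retained term the certificate is then: two `norm_num` evaluations (the enclosure end-point and `V` there).  A Lipschitz constant is
not needed (monotonicity is exact and tighter); second-order information enters only through the box widths chosen by the search.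
-/

noncomputable section

open Literature.MathematicalPhysics.StatisticalMechanics

namespace Summit.AtomisticToContinuum.Crystallization.Theorems.NashClassCertificatesNashNearField

/-- `V_LJ(√q) = q⁻⁶/12 − q⁻³/6` for `q > 0`. [folklore] -/
theorem tri_lj_sqrt_eq {q : ℝ} (hq : 0 < q) :
    lennardJones (Real.sqrt q) = (1 / 12) * q⁻¹ ^ 6 - (1 / 6) * q⁻¹ ^ 3 := by
  unfold lennardJones
  have e : (Real.sqrt q)⁻¹ ^ 12 = q⁻¹ ^ 6 := by
    rw [inv_pow, inv_pow, show (12 : ℕ) = 2 * 6 by rfl, pow_mul, Real.sq_sqrt hq.le]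
  have e' : (Real.sqrt q)⁻¹ ^ 6 = q⁻¹ ^ 3 := by
    rw [inv_pow, inv_pow, show (6 : ℕ) = 2 * 3 by rfl, pow_mul, Real.sq_sqrt hq.le]
  rw [e, e']

/-- `q ↦ V_LJ(√q)` is increasing on `[1, ∞)`. [folklore] -/
theorem tri_lj_sqrt_mono {q₁ q₂ : ℝ} (h1 : 1 ≤ q₁) (h12 : q₁ ≤ q₂) :
    lennardJones (Real.sqrt q₁) ≤ lennardJones (Real.sqrt q₂) := by
  have hq1 : 0 < q₁ := by linarith
  have hq2 : 0 < q₂ := by linarith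
  rw [tri_lj_sqrt_eq hq1, tri_lj_sqrt_eq hq2]
  set u₁ : ℝ := q₁⁻¹ ^ 3 with hu₁
  set u₂ : ℝ := q₂⁻¹ ^ 3 with hu₂
  have e1 : q₁⁻¹ ^ 6 = u₁ ^ 2 := by rw [hu₁, ← pow_mul]
  have e2 : q₂⁻¹ ^ 6 = u₂ ^ 2 := by rw [hu₂, ← pow_mul]
  have hu1le : u₁ ≤ 1 := by
    rw [hu₁]; exact pow_le_one₀ (by positivity) (inv_le_one_of_one_le₀ h1)
  have hu21 : u₂ ≤ u₁ := by
    rw [hu₁, hu₂]; gcongr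
  have hu20 : 0 ≤ u₂ := by positivity
  rw [e1, e2]
  nlinarith [mul_nonneg (sub_nonneg.2 hu21) (by linarith : (0 : ℝ) ≤ 2 - u₁ - u₂)]

/-- `q ↦ V_LJ(√q)` is decreasing on `(0, 1]`. [folklore] -/
theorem tri_lj_sqrt_anti {q₁ q₂ : ℝ} (h0 : 0 < q₁) (h12 : q₁ ≤ q₂) (h2 : q₂ ≤ 1) :
    lennardJones (Real.sqrt q₂) ≤ lennardJones (Real.sqrt q₁) := by
  have hq2 : 0 < q₂ := by linarith
  rw [tri_lj_sqrt_eq h0, tri_lj_sqrt_eq hq2]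
  set u₁ : ℝ := q₁⁻¹ ^ 3 with hu₁
  set u₂ : ℝ := q₂⁻¹ ^ 3 with hu₂
  have e1 : q₁⁻¹ ^ 6 = u₁ ^ 2 := by rw [hu₁, ← pow_mul]
  have e2 : q₂⁻¹ ^ 6 = u₂ ^ 2 := by rw [hu₂, ← pow_mul]
  have hu2ge : 1 ≤ u₂ := by
    rw [hu₂]; exact one_le_pow₀ (one_le_inv₀ hq2 |>.2 h2)
  have hu21 : u₂ ≤ u₁ := by
    rw [hu₁, hu₂]; gcongr
  rw [e1, e2]
  nlinarith [mul_nonneg (sub_nonneg.2 hu21) (by linarith : (0 : ℝ) ≤ u₁ + u₂ - 2)]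

/-- `V_LJ(√q) ≥ −1/12`. [folklore] -/
theorem tri_lj_sqrt_ge (q : ℝ) : -1 / 12 ≤ lennardJones (Real.sqrt q) :=
  neg_one_div_le_lennardJones _

/-- **Term-wise lower bound on an enclosure**: if `0 < lo ≤ q ≤ hi` then `V_LJ(√q)` is at least `V_LJ(√lo)` when `1 ≤ lo`,
at least `V_LJ(√hi)` when `hi ≤ 1`, and at least `−1/12` in any case. [folklore] -/
theorem tri_lj_sqrt_ge_of_mem {lo hi q : ℝ} (hlo : 0 < lo) (h1 : lo ≤ q) (h2 : q ≤ hi) :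
    (if 1 ≤ lo then lennardJones (Real.sqrt lo) else if hi ≤ 1 then lennardJones (Real.sqrt hi) else -1 / 12) ≤
      lennardJones (Real.sqrt q) := by
  split_ifs with hA hB
  · exact tri_lj_sqrt_mono hA h1
  · exact tri_lj_sqrt_anti (by linarith) h2 hB
  · exact tri_lj_sqrt_ge q

/-- Deviation of a linear form on a box: `|t₀X + t₁Y + t₂Z − (c₀X + c₁Y + c₂Z)| ≤ ε₀|X| + ε₁|Y| + ε₂|Z|`. [folklore] -/
theorem tri_linform_dev {t₀ t₁ t₂ c₀ c₁ c₂ ε₀ ε₁ ε₂ : ℝ} (h0 : |t₀ - c₀| ≤ ε₀) (h1 : |t₁ - c₁| ≤ ε₁) (h2 : |t₂ - c₂| ≤ ε₂)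
    (X Y Z : ℝ) :
    |t₀ * X + t₁ * Y + t₂ * Z - (c₀ * X + c₁ * Y + c₂ * Z)| ≤ ε₀ * |X| + ε₁ * |Y| + ε₂ * |Z| := by
  have e : t₀ * X + t₁ * Y + t₂ * Z - (c₀ * X + c₁ * Y + c₂ * Z) =
      (t₀ - c₀) * X + (t₁ - c₁) * Y + (t₂ - c₂) * Z := by ring
  rw [e]
  calc |(t₀ - c₀) * X + (t₁ - c₁) * Y + (t₂ - c₂) * Z|
      ≤ |(t₀ - c₀) * X| + |(t₁ - c₁) * Y| + |(t₂ - c₂) * Z| := abs_add_three _ _ _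
    _ = |t₀ - c₀| * |X| + |t₁ - c₁| * |Y| + |t₂ - c₂| * |Z| := by rw [abs_mul, abs_mul, abs_mul]
    _ ≤ ε₀ * |X| + ε₁ * |Y| + ε₂ * |Z| := by
        gcongr

/-- Upper square bound from a deviation: `|u − u₀| ≤ ρ ⇒ u² ≤ (|u₀| + ρ)²`. [folklore] -/
theorem tri_sq_le_of_dev {u u₀ ρ : ℝ} (h : |u - u₀| ≤ ρ) : u ^ 2 ≤ (|u₀| + ρ) ^ 2 := by
  have hρ : 0 ≤ ρ := (abs_nonneg _).trans h
  have hu : |u| ≤ |u₀| + ρ := by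
    calc |u| = |u₀ + (u - u₀)| := by ring_nf
      _ ≤ |u₀| + |u - u₀| := abs_add_le _ _
      _ ≤ |u₀| + ρ := by linarith
  calc u ^ 2 = |u| ^ 2 := (sq_abs u).symm
    _ ≤ (|u₀| + ρ) ^ 2 := pow_le_pow_left₀ (abs_nonneg u) hu 2

/-- Lower square bound from a deviation: `|u − u₀| ≤ ρ ≤ |u₀| ⇒ (|u₀| − ρ)² ≤ u²`. [folklore] -/
theorem tri_sq_ge_of_dev {u u₀ ρ : ℝ} (h : |u - u₀| ≤ ρ) (hρ : ρ ≤ |u₀|) : (|u₀| - ρ) ^ 2 ≤ u ^ 2 := by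
  have hu : |u₀| - ρ ≤ |u| := by
    have := abs_sub_abs_le_abs_sub u₀ u
    rw [abs_sub_comm] at this
    linarith
  calc (|u₀| - ρ) ^ 2 ≤ |u| ^ 2 := pow_le_pow_left₀ (sub_nonneg.2 hρ) hu 2
    _ = u ^ 2 := sq_abs u

/-- Lower square bound with the positive part (no side condition): `|u − u₀| ≤ ρ ⇒ (max (|u₀| − ρ) 0)² ≤ u²`. [folklore] -/
theorem tri_sq_ge_of_dev' {u u₀ ρ : ℝ} (h : |u - u₀| ≤ ρ) : (max (|u₀| - ρ) 0) ^ 2 ≤ u ^ 2 := by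
  rcases le_or_gt ρ |u₀| with hρ | hρ
  · rw [max_eq_left (sub_nonneg.2 hρ)]; exact tri_sq_ge_of_dev h hρ
  · rw [max_eq_right (by linarith)]
    simp only [ne_eq, OfNat.ofNat_ne_zero, not_false_eq_true, zero_pow]
    positivity

/-- **The enclosure of the deformed squared distance over a box (upper end-point).**  On `|t_k − c_k| ≤ ε_k`,
`q_t(X,Y,Z) ≤ ∑_r (|L_r(c)| + ρ_r)²`. [folklore] -/
theorem tri_qbox_le {t₀₀ t₀₁ t₀₂ t₁₁ t₁₂ t₂₂ c₀₀ c₀₁ c₀₂ c₁₁ c₁₂ c₂₂ ε₀₀ ε₀₁ ε₀₂ ε₁₁ ε₁₂ ε₂₂ : ℝ}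
    (h00 : |t₀₀ - c₀₀| ≤ ε₀₀) (h01 : |t₀₁ - c₀₁| ≤ ε₀₁) (h02 : |t₀₂ - c₀₂| ≤ ε₀₂)
    (h11 : |t₁₁ - c₁₁| ≤ ε₁₁) (h12 : |t₁₂ - c₁₂| ≤ ε₁₂) (h22 : |t₂₂ - c₂₂| ≤ ε₂₂) (X Y Z : ℝ) :
    (t₀₀ * X + t₀₁ * Y + t₀₂ * Z) ^ 2 + (t₁₁ * Y + t₁₂ * Z) ^ 2 + (t₂₂ * Z) ^ 2 ≤
      (|c₀₀ * X + c₀₁ * Y + c₀₂ * Z| + (ε₀₀ * |X| + ε₀₁ * |Y| + ε₀₂ * |Z|)) ^ 2 +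
        (|c₁₁ * Y + c₁₂ * Z| + (ε₁₁ * |Y| + ε₁₂ * |Z|)) ^ 2 + (|c₂₂ * Z| + ε₂₂ * |Z|) ^ 2 := by
  have d0 := tri_linform_dev h00 h01 h02 X Y Z
  have d1 : |t₁₁ * Y + t₁₂ * Z - (c₁₁ * Y + c₁₂ * Z)| ≤ ε₁₁ * |Y| + ε₁₂ * |Z| := by
    have := tri_linform_dev h11 h12 h12 Y Z 0
    simp only [mul_zero, add_zero, abs_zero] at this
    exact this
  have d2 : |t₂₂ * Z - c₂₂ * Z| ≤ ε₂₂ * |Z| := by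
    rw [← sub_mul, abs_mul]; exact mul_le_mul_of_nonneg_right h22 (abs_nonneg Z)
  exact add_le_add_three (tri_sq_le_of_dev d0) (tri_sq_le_of_dev d1) (tri_sq_le_of_dev d2)

/-- **The enclosure of the deformed squared distance over a box (lower end-point).**  On `|t_k − c_k| ≤ ε_k`,
`∑_r (max (|L_r(c)| − ρ_r) 0)² ≤ q_t(X,Y,Z)`. [folklore] -/
theorem tri_qbox_ge {t₀₀ t₀₁ t₀₂ t₁₁ t₁₂ t₂₂ c₀₀ c₀₁ c₀₂ c₁₁ c₁₂ c₂₂ ε₀₀ ε₀₁ ε₀₂ ε₁₁ ε₁₂ ε₂₂ : ℝ}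
    (h00 : |t₀₀ - c₀₀| ≤ ε₀₀) (h01 : |t₀₁ - c₀₁| ≤ ε₀₁) (h02 : |t₀₂ - c₀₂| ≤ ε₀₂)
    (h11 : |t₁₁ - c₁₁| ≤ ε₁₁) (h12 : |t₁₂ - c₁₂| ≤ ε₁₂) (h22 : |t₂₂ - c₂₂| ≤ ε₂₂) (X Y Z : ℝ) :
    (max (|c₀₀ * X + c₀₁ * Y + c₀₂ * Z| - (ε₀₀ * |X| + ε₀₁ * |Y| + ε₀₂ * |Z|)) 0) ^ 2 +
        (max (|c₁₁ * Y + c₁₂ * Z| - (ε₁₁ * |Y| + ε₁₂ * |Z|)) 0) ^ 2 + (max (|c₂₂ * Z| - ε₂₂ * |Z|) 0) ^ 2 ≤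
      (t₀₀ * X + t₀₁ * Y + t₀₂ * Z) ^ 2 + (t₁₁ * Y + t₁₂ * Z) ^ 2 + (t₂₂ * Z) ^ 2 := by
  have d0 := tri_linform_dev h00 h01 h02 X Y Z
  have d1 : |t₁₁ * Y + t₁₂ * Z - (c₁₁ * Y + c₁₂ * Z)| ≤ ε₁₁ * |Y| + ε₁₂ * |Z| := by
    have := tri_linform_dev h11 h12 h12 Y Z 0
    simp only [mul_zero, add_zero, abs_zero] at this
    exact this
  have d2 : |t₂₂ * Z - c₂₂ * Z| ≤ ε₂₂ * |Z| := by
    rw [← sub_mul, abs_mul]; exact mul_le_mul_of_nonneg_right h22 (abs_nonneg Z)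
  exact add_le_add_three (tri_sq_ge_of_dev' d0) (tri_sq_ge_of_dev' d1) (tri_sq_ge_of_dev' d2)

end Summit.AtomisticToContinuum.Crystallization.Theorems.NashClassCertificatesNashNearField

end
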